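import Summits.ABC.ABC.Theses.IneffectiveSubspace
import Summits.ABC.ABC.Theorems.IneffectiveSubspaceDepthCountedABCStubCalibration

/-!
# `DepthCountedABC` (stmt-ABC-14938): calibration of the constants on the 5-free cell

Negative-side support lemmas (tightness / refuted constant-free strengthenings) for the crux
`Summit.ABC.ABC.Theses.IneffectiveSubspace.DepthCountedABC` on its base cell `K = 0` (5-free `abc`),
from the crux disprover's cycle-1 attack (`Cruxes/DepthCountedABC/Disproof.lean`, section C):

* the witness `(1, 80, 81) = (1, 2⁴·5, 3⁴)`: an abc triple, `rad = 30`, `ω₅ = 0`, quality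
  `log 81 / log 30 = 1.29203` — the cell-0 record among all abc triples with `c ≤ 3·10⁸`
  (kit j015220, `Cruxes/DepthCountedABC/BarrierNotes-r1-k2.md` §6);
* `cellZero_constant_floor` — every admissible `C(0, ε)` has `81 < C · 30^(1+ε)`;
* `depthCountedABC_not_constFree` — the constant-free form (`C = 1` for every `ε > 0`) is FALSE on
  the cell: at `ε = 1/4`, `30^(5/4) ≤ 81` (`30⁵ ≤ 81⁴`);
* `cellZero_explicit_floor` — no constant-one form `c < rad(abc)^θ` holds on the 5-free cell for
  `θ ≤ 1.29` (`30¹²⁹ ≤ 81¹⁰⁰`), the cell-0 analogue of `Literature.Barriers.ABC.ExplicitABCQualityFloor`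
  (Reyssat's `1.62991` for all triples, a triple with `ω₅ = 2`);
* the 4-free witness `(1, 23³, 2³3²13²)` (quality `1.2555`): even the 4-free cell is non-trivial,
  whereas the CUBE-free cell is trivial (`cubeFree_sq_le`: `c² ≤ 2·rad²`) and the 5-free cell holds
  for free at exponent `2` (the lead's landed `Summit.ABC.ABC.Theorems.DepthCountedABC.calibration_zero`:
  `c² ≤ 2·rad⁴`, whose helper lemmas this file reuses).
-/

-- `Summit.<Summit>.<Problem>` is the mandated summit-side namespace (CONVENTIONS §2); for the
-- single-conjunct summit `ABC` the two coincide, so the duplicate `ABC.ABC` is deliberate.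
set_option linter.dupNamespace false

namespace Summit.ABC.ABC.Theorems.DepthCountedABC.Negative

open Literature.NumberTheory.DiophantineGeometry UniqueFactorizationMonoid

/-- If no prime divides `n ≠ 0` to the fifth power then `ω₅(n) = 0`. [folklore] -/
theorem card_deep_eq_zero {n : ℕ} (hn : n ≠ 0) (h : ∀ p, p.Prime → ¬ p ^ 5 ∣ n) :
    (n.primeFactors.filter (fun p => 5 ≤ n.factorization p)).card = 0 := by
  rw [Finset.card_eq_zero, Finset.filter_eq_empty_iff]
  intro p hp h5
  have hpp := Nat.prime_of_mem_primeFactors hp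
  exact h p hpp ((hpp.pow_dvd_iff_le_factorization hn).mpr h5)

/-- `(1, 80, 81)` is an abc triple. [folklore] -/
theorem isABCTriple_1_80_81 : IsABCTriple 1 80 81 :=
  ⟨one_pos, by norm_num, by norm_num, Nat.coprime_one_left _⟩

/-- `rad(1 · 80 · 81) = rad(2⁴ · 3⁴ · 5) = 30`. [folklore] -/
theorem rad_1_80_81 : rad 1 80 81 = 30 := by
  rw [rad_def, Nat.radical_eq_prod_primeFactors,
    show (1 * 80 * 81 : ℕ) = (2 ^ 4 * 3 ^ 4) * 5 ^ 1 by norm_num,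
    Nat.primeFactors_mul (by norm_num) (by norm_num), Nat.primeFactors_mul (by norm_num) (by norm_num),
    Nat.primeFactors_prime_pow (by norm_num) Nat.prime_two,
    Nat.primeFactors_prime_pow (by norm_num) Nat.prime_three,
    Nat.primeFactors_prime_pow (by norm_num) Nat.prime_five]
  decide

/-- `(1, 80, 81)` is 5-free: `ω₅(6480) = 0`. [folklore] -/
theorem card_deep_1_80_81 :
    ((1 * 80 * 81).primeFactors.filter (fun p => 5 ≤ (1 * 80 * 81).factorization p)).card = 0 := by
  apply card_deep_eq_zero (by norm_num)
  intro p hp h5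
  have hp81 : p ∣ 2 ^ 4 * 3 ^ 4 * 5 := by
    have : p ∣ 1 * 80 * 81 := dvd_trans (dvd_pow_self p (by norm_num)) h5
    simpa using this
  have hp235 : p = 2 ∨ p = 3 ∨ p = 5 := by
    rcases (Nat.Prime.dvd_mul hp).mp hp81 with h | h
    · rcases (Nat.Prime.dvd_mul hp).mp h with h | h
      · exact Or.inl ((Nat.prime_dvd_prime_iff_eq hp Nat.prime_two).mp (hp.dvd_of_dvd_pow h))
      · exact Or.inr (Or.inl ((Nat.prime_dvd_prime_iff_eq hp Nat.prime_three).mp (hp.dvd_of_dvd_pow h)))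
    · exact Or.inr (Or.inr ((Nat.prime_dvd_prime_iff_eq hp Nat.prime_five).mp h))
  rcases hp235 with rfl | rfl | rfl <;> revert h5 <;> decide

/-- **Constant floor on the 5-free cell.**  Every constant `C` admissible for the cell `K = 0` of
`DepthCountedABC` at exponent `1 + ε` satisfies `81 < C · 30^(1+ε)` (witness `(1, 2⁴·5, 3⁴)`, quality
`1.29203`). [folklore] -/
theorem cellZero_constant_floor {ε C : ℝ}
    (h : ∀ a b c : ℕ, IsABCTriple a b c →
      ((a * b * c).primeFactors.filter (fun p => 5 ≤ (a * b * c).factorization p)).card ≤ 0 →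
      (c : ℝ) < C * ((rad a b c : ℕ) : ℝ) ^ (1 + ε)) :
    (81 : ℝ) < C * (30 : ℝ) ^ (1 + ε) := by
  have := h 1 80 81 isABCTriple_1_80_81 (le_of_eq card_deep_1_80_81)
  rw [rad_1_80_81] at this
  exact_mod_cast this

/-- `30^(5/4) ≤ 81` (since `30⁵ = 24 300 000 ≤ 43 046 721 = 81⁴`). [folklore] -/
theorem rpow_thirty_five_fourths_le : (30 : ℝ) ^ ((1 : ℝ) + 1 / 4) ≤ 81 := by
  have h1 : (1 : ℝ) + 1 / 4 = ((5 : ℕ) : ℝ) * (((4 : ℕ) : ℝ))⁻¹ := by norm_num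
  rw [h1, Real.rpow_natCast_mul (by norm_num : (0 : ℝ) ≤ 30)]
  have h81 : ((81 : ℝ) ^ (4 : ℕ)) ^ (((4 : ℕ) : ℝ))⁻¹ = 81 :=
    Real.pow_rpow_inv_natCast (by norm_num : (0 : ℝ) ≤ 81) (by norm_num : (4 : ℕ) ≠ 0)
  rw [← h81]
  exact Real.rpow_le_rpow (by norm_num) (by norm_num) (by positivity)

/-- **The constant-free form of `DepthCountedABC` is false** (natural strengthening refuted): "`c <
rad(abc)^(1+ε)` for every `ε > 0` on every cell" fails on the cell `K = 0` at `ε = 1/4` with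
`(1, 80, 81)` (`81 ≥ 30^(5/4) ≈ 70.2`).  So `C(0, ε) > 1` is forced for `ε ≤ 1/4` (indeed for every
`ε < 0.29203`). [folklore] -/
theorem depthCountedABC_not_constFree :
    ¬ ∀ K : ℕ, ∀ ε : ℝ, 0 < ε → ∀ a b c : ℕ, IsABCTriple a b c →
      ((a * b * c).primeFactors.filter (fun p => 5 ≤ (a * b * c).factorization p)).card ≤ K →
      (c : ℝ) < ((rad a b c : ℕ) : ℝ) ^ (1 + ε) := by
  intro h
  have := h 0 (1 / 4) (by norm_num) 1 80 81 isABCTriple_1_80_81 (le_of_eq card_deep_1_80_81)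
  rw [rad_1_80_81] at this
  push_cast at this
  linarith [rpow_thirty_five_fourths_le]

/-- `30^(129/100) ≤ 81`, by the exact integer comparison `30¹²⁹ ≤ 81¹⁰⁰`. [folklore] -/
theorem rpow_thirty_le_eightyone : (30 : ℝ) ^ ((129 : ℝ) / 100) ≤ 81 := by
  have h1 : (129 : ℝ) / 100 = ((129 : ℕ) : ℝ) * (((100 : ℕ) : ℝ))⁻¹ := by norm_num
  rw [h1, Real.rpow_natCast_mul (by norm_num : (0 : ℝ) ≤ 30)]
  have h81 : ((81 : ℝ) ^ (100 : ℕ)) ^ (((100 : ℕ) : ℝ))⁻¹ = 81 :=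
    Real.pow_rpow_inv_natCast (by norm_num : (0 : ℝ) ≤ 81) (by norm_num : (100 : ℕ) ≠ 0)
  rw [← h81]
  apply Real.rpow_le_rpow (by norm_num) ?_ (by positivity)
  have : (30 : ℕ) ^ 129 ≤ 81 ^ 100 := by norm_num
  exact_mod_cast this

/-- **Explicit-exponent floor on the 5-free cell** (cell-0 analogue of
`Literature.Barriers.ABC.ExplicitABCQualityFloor`): no constant-one form `c < rad(abc)^θ` holds for
all 5-free abc triples when `θ ≤ 1.29` — witness `(1, 80, 81)` of quality `1.29203`. (For ALL triples
the floor is Reyssat's `1.62991`, attained with `ω₅ = 2`.) [folklore] -/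
theorem cellZero_explicit_floor {θ : ℝ} (hθ : θ ≤ 129 / 100) :
    ¬ ∀ a b c : ℕ, IsABCTriple a b c →
      ((a * b * c).primeFactors.filter (fun p => 5 ≤ (a * b * c).factorization p)).card = 0 →
      (c : ℝ) < ((rad a b c : ℕ) : ℝ) ^ θ := by
  intro h
  have := h 1 80 81 isABCTriple_1_80_81 card_deep_1_80_81
  rw [rad_1_80_81] at this
  push_cast at this
  have hmono : (30 : ℝ) ^ θ ≤ (30 : ℝ) ^ ((129 : ℝ) / 100) :=
    Real.rpow_le_rpow_of_exponent_le (by norm_num) hθ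
  linarith [rpow_thirty_le_eightyone]

/-- The 4-free witness `(1, 23³, 2³3²13²) = (1, 12167, 12168)` is an abc triple … [folklore] -/
theorem isABCTriple_1_12167_12168 : IsABCTriple 1 12167 12168 :=
  ⟨one_pos, by norm_num, by norm_num, Nat.coprime_one_left _⟩

/-- … with radical `2·3·13·23 = 1794` (quality `log 12168 / log 1794 = 1.2555`) … [folklore] -/
theorem rad_1_12167_12168 : rad 1 12167 12168 = 1794 := by
  rw [rad_def, Nat.radical_eq_prod_primeFactors,
    show (1 * 12167 * 12168 : ℕ) = ((23 ^ 3 * 2 ^ 3) * 3 ^ 2) * 13 ^ 2 by norm_num,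
    Nat.primeFactors_mul (by norm_num) (by norm_num), Nat.primeFactors_mul (by norm_num) (by norm_num),
    Nat.primeFactors_mul (by norm_num) (by norm_num),
    Nat.primeFactors_prime_pow (by norm_num) (by norm_num : Nat.Prime 23),
    Nat.primeFactors_prime_pow (by norm_num) Nat.prime_two,
    Nat.primeFactors_prime_pow (by norm_num) Nat.prime_three,
    Nat.primeFactors_prime_pow (by norm_num) (by norm_num : Nat.Prime 13)]
  decide

/-- … in which every prime has exponent `≤ 3`: it lies in the 4-free (a fortiori 5-free) cell.
[folklore] -/
theorem fourFree_1_12167_12168 : ∀ p, p.Prime → ¬ p ^ 4 ∣ 1 * 12167 * 12168 := by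
  intro p hp h4
  have hpd : p ∣ 23 ^ 3 * 2 ^ 3 * 3 ^ 2 * 13 ^ 2 := by
    have : p ∣ 1 * 12167 * 12168 := dvd_trans (dvd_pow_self p (by norm_num)) h4
    simpa using this
  have hp' : p = 23 ∨ p = 2 ∨ p = 3 ∨ p = 13 := by
    rcases (Nat.Prime.dvd_mul hp).mp hpd with h | h
    · rcases (Nat.Prime.dvd_mul hp).mp h with h | h
      · rcases (Nat.Prime.dvd_mul hp).mp h with h | h
        · exact Or.inl ((Nat.prime_dvd_prime_iff_eq hp (by norm_num)).mp (hp.dvd_of_dvd_pow h))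
        · exact Or.inr (Or.inl ((Nat.prime_dvd_prime_iff_eq hp Nat.prime_two).mp (hp.dvd_of_dvd_pow h)))
      · exact Or.inr (Or.inr (Or.inl
          ((Nat.prime_dvd_prime_iff_eq hp Nat.prime_three).mp (hp.dvd_of_dvd_pow h))))
    · exact Or.inr (Or.inr (Or.inr ((Nat.prime_dvd_prime_iff_eq hp (by norm_num)).mp (hp.dvd_of_dvd_pow h))))
  rcases hp' with rfl | rfl | rfl | rfl <;> revert h4 <;> decide

/-- `ω₅(1 · 23³ · 2³3²13²) = 0`. [folklore] -/
theorem card_deep_1_12167_12168 :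
    ((1 * 12167 * 12168).primeFactors.filter
      (fun p => 5 ≤ (1 * 12167 * 12168).factorization p)).card = 0 :=
  card_deep_eq_zero (by norm_num) fun p hp h5 =>
    fourFree_1_12167_12168 p hp (dvd_trans (pow_dvd_pow p (by norm_num)) h5)

/-- **Calibration: the CUBE-free cell is trivial** (`c² ≤ 2·rad²`: exponent 1, constant `√2`; after
ideator 2's `cubeFreeTrivial_holds`, via the lead's landed calibration helpers).  Depth thresholds `≤ 3`
carry no content, `4` already does (`(1, 23³, 2³3²13²)`, quality 1.2555), `5` is the crux; the 5-free
cell at exponent 2 is `Summit.ABC.ABC.Theorems.DepthCountedABC.calibration_zero`. [folklore] -/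
theorem cubeFree_sq_le {a b c : ℕ} (h : IsABCTriple a b c)
    (h3 : ∀ p ∈ (a * b * c).primeFactors, (a * b * c).factorization p ≤ 2) :
    c ^ 2 ≤ 2 * (rad a b c) ^ 2 := by
  have hne : a * b * c ≠ 0 := by
    obtain ⟨ha, hb, hsum, -⟩ := h
    have hc : 0 < c := by omega
    positivity
  calc c ^ 2 ≤ 2 * (a * b * c) := calibration_sq_le_two_mul_prod h
    _ ≤ 2 * (radical (a * b * c)) ^ 2 :=
        Nat.mul_le_mul_left 2 (calibration_le_radical_pow_of_factorization_le hne h3)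
    _ = 2 * (rad a b c) ^ 2 := by rw [rad_def]

end Summit.ABC.ABC.Theorems.DepthCountedABC.Negative
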